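import Literature.Probability.NegativeDependence.NegativeAssociationHierarchy
import Literature.Probability.NegativeDependence.SymmetricExclusionNonPreservation
import Literature.Combinatorics.StablePolynomials.AffineDeterminantalPencil
import Literature.LinearAlgebra.Matrix.PrincipalMinorMap
import Literature.LinearAlgebra.Matrix.FischerInequality
import Literature.Analysis.Matrix.DetAddDiagonalMinors
import HarnessLib

/-!
# Rayleigh matrices and GKK-matrices (Borcea–Brändén–Liggett §3.2, Definition 3.1, Theorem 3.3)

J. Borcea, P. Brändén, T. M. Liggett, *Negative dependence and the geometry of polynomials*, J. Amer. Math. Soc.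
22 (2009) 521–567 (arXiv:0707.2340, held `paper:arxiv-0707.2340`, arXiv numbering), §3.2 «Hadamard–Fischer
Inequalities and GKK-Matrices» (arXiv p. 11), verbatim:

> Given an `n × n` matrix `A` over `ℂ` and `S ⊆ [n]` denote by `A[S]` the principal submatrix of `A` with rows and
> columns indexed by `S` and let `A⟨S⟩ = det(A[S'])` be the principal minor of `A` with rows and columns indexed
> by `S' = [n] ∖ S`, where `A⟨[n]⟩ = det(A[∅]) := 1`. The matrix `A` is called a P-matrix if all its principal
> minors are positive. […] A P-matrix `A` is a GKK-matrix (after Gantmacher–Krein and Kotelyansky) if it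
> satisfies the Hadamard–Fischer–Kotelyansky inequalities, that is,
> `A⟨S⟩ A⟨T⟩ ≥ A⟨S ∪ T⟩ A⟨S ∩ T⟩`, `S, T ⊆ [n]`. In other words, an `n × n` P-matrix `A` is GKK if and only if
> the probability measure `μ_A` on `2^{[n]}` defined by `μ_A(S) = A⟨S⟩ det(A + I)^{−1}` satisfies the negative
> lattice condition (NLC). It is not hard to see that the generating polynomial of such a measure is
> `g_{μ_A}(z) = det(A+I)^{−1} Σ_{S ⊆ [n]} A⟨S⟩ z^S = det(A + I)^{−1} det(A + Z)`, where `Z = diag(z_1, …, z_n)`.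
> […] **Definition 3.1.** We say that a P-matrix `A` is a Rayleigh matrix if the associated probability measure
> `μ_A` is Rayleigh (in the sense of Definition 2.5). By [W], Rayleigh matrices are GKK. In fact, the following
> holds. **Theorem 3.3.** Let `A` be an `n × n` matrix over `ℂ`. The following are equivalent:
> (1) `A` is a Rayleigh matrix; (2) `A + X` is a GKK-matrix for all `X = diag(x_1, …, x_n)`, where `x_i ≥ 0` for
> all `1 ≤ i ≤ n`. *Proof.* (1) ⇒ (2): As we already noted, by [W] Rayleigh matrices are GKK and by definition
> the set of all Rayleigh matrices is obviously closed under adding positive diagonal matrices. (2) ⇒ (1): Let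
> `f = det(A + Z)`. Then `∂f/∂z_i(x) ∂f/∂z_j(x) − ∂²f/∂z_i∂z_j(x) f(x) = (A+X)⟨i⟩·(A+X)⟨j⟩ − (A+X)⟨i,j⟩·(A+X)⟨∅⟩`.
> Using the Hadamard–Fischer–Kotelyansky inequalities for `A + X` with `S = {i}` and `T = {j}` one gets the
> desired conclusion.

## What is here (real matrices; vocabulary of `RayleighMeasures`, `RayleighTranslationDilution`,
## `RayleighLogSubmodular`, `LinearAlgebra.Matrix.PrincipalMinorMap`)

Matrices are REAL (`Matrix n n ℝ`): for a P-matrix all principal minors are real, and the tree's weights are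
real-valued. -- TODO(general form): complex entries with (necessarily real) positive principal minors.

* §1 `IsPMatrix A`, **`coMinorWeight A`** (`S ↦ A⟨S⟩ = det A[Sᶜ]`, the UNNORMALISED `μ_A` — the tree's weights are
  not normalised; `det(A+I) > 0` is `coMinorWeight_mass_pos`), `IsGKK A` (P-matrix + Hadamard–Fischer–Kotelyansky,
  literally «`μ_A` satisfies NLC»: `isGKK_iff_isNLC`), **`IsRayleighMatrix A`** (Def. 3.1).
* §2 «`g_{μ_A}(z) = Σ_S A⟨S⟩ z^S = det(A + Z)`»: **`eval_multiAffine_coMinorWeight`**, `multiAffine_injective`,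
  **`coMinorWeight_add_diagonal`** (`μ_{A+X} = ` the translate `translW x μ_A`, i.e. `g_{μ_{A+X}}(z) = g_{μ_A}(z+x)`).
* §3 Values of a translate: `translW_eq_sum_disjoint`, `translW_empty` (`= g_μ(a)`), `translW_singleton`
  (`= ∂_i g_μ(a)`), `translW_pair` (`= ∂_i∂_j g_μ(a)`), `le_translW`; hence the general principle behind (2) ⇒ (1):
  **`isRayleigh_of_forall_isNLC_translW`** (if every translate `g_μ(z + a)`, `a > 0`, is NLC then `μ` is Rayleigh)
  and `IsRayleigh.isNLC_translW` (the converse for `μ ≥ 0`, by the tree's Prop. 2.1 (2) and Wagner's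
  Rayleigh ⟹ NLC).
* §4 **`BorceaBrandenLiggett_thm_3_3`** (`A` is a Rayleigh matrix iff `A + X` is GKK for all diagonal `X ≥ 0`),
  `IsRayleighMatrix.isGKK` («by [W], Rayleigh matrices are GKK»), `IsRayleighMatrix.add_diagonal` («closed under
  adding positive diagonal matrices»).
* §5 «Examples of GKK-matrices are: (I) Positive definite matrices» and «It follows immediately from Theorem 3.3
  that … positive definite matrices are Rayleigh»: `principalMinorMap_eq_det_submatrix_subtype` (bridge to the
  predicate-indexed minors of the tree's `FischerInequality`), **`isGKK_of_posDef`** (Koteljanskii's inequality,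
  tree `det_submatrix_union_mul_det_submatrix_inter_le`), **`isRayleighMatrix_of_posDef`**,
  `isRayleigh_coMinorWeight_of_posDef`.
* §6 «In particular, if `Z = diag(z_1,…,z_m)` and `A` is a positive semi-definite matrix then `det(A+Z)` is a
  multi-affine real stable polynomial with all non-negative coefficients, hence a (positive) constant multiple
  of a strongly Rayleigh polynomial» (§3.1 Prop. 3.2, arXiv p. 10): `affinePencilMatrix_diagonal_single`
  (`A + Z = Σ_i z_i E_ii + A`), `multiAffine_coMinorWeight` (`g_{μ_A} = det(A + Z)` as polynomials),
  **`stableOrZero_coMinorWeight_of_posSemidef`**, `isRealStable_multiAffine_coMinorWeight_of_posSemidef`,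
  `coMinorWeight_nonneg_of_posSemidef`, `isCNAPlus_coMinorWeight_of_posSemidef` (Thm. 4.9).
* §7 «the measures associated with positive definite … matrices have ULC rank sequences» (§3.2, arXiv p. 11;
  BBL: Newton's inequalities + real-rootedness — here through the tree's route strongly Rayleigh ⟹
  symmetrization NLC ⟹ ULC, Thm. 3.7): the general **`StableOrZero.isUltraLogConcave_rankSeq`** («the ULC
  property for rank sequences» of strongly Rayleigh measures, §3 list) and
  `isUltraLogConcave_rankSeq_coMinorWeight_of_posSemidef`.

No `sorry`, no named fact, no instance/notation.

## References

* [BorceaBrandenLiggett2007] — §3.2, Def. 3.1, Thm. 3.3; §2.1 Def. 2.5, Prop. 2.1 (2).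
* [Wagner2008] D. G. Wagner, Negatively correlated random variables and Mason's conjecture, Ann. Comb. 12 (2008)
  (Rayleigh ⟹ NLC; the tree's `IsRayleigh.isNLC`).
* [HornJohnson2013] R. A. Horn, C. R. Johnson, Matrix Analysis, Thm 7.8.9 (Koteljanskii; the tree's
  `FischerInequality.det_submatrix_union_mul_det_submatrix_inter_le`).
-/

noncomputable section

open Finset Matrix MvPolynomial
open Literature.Combinatorics.StablePolynomials
open Literature.LinearAlgebra.Matrix
open Literature.Analysis.Matrix
open Literature.Combinatorics.LorentzianPolynomials (IsUltraLogConcave)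

namespace Literature.Probability.NegativeDependence

/-! ## §1 P-matrices, `A⟨S⟩`, GKK-matrices, Rayleigh matrices -/

section Defs

variable {n : Type*} [Fintype n] [DecidableEq n]

/-- **P-matrix**: «all its principal minors are positive» (`det A[S] > 0` for every `S`, the tree's
`principalMinorMap`, `A[∅]` included). [cite: BorceaBrandenLiggett2007, §3.2 (P-matrix)] -/
def IsPMatrix (A : Matrix n n ℝ) : Prop := ∀ S : Finset n, 0 < principalMinorMap A S

/-- **`μ_A(S) = A⟨S⟩ = det A[[n] ∖ S]`**, the (unnormalised) weight of the P-matrix `A` on `2^{[n]}`.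
[cite: BorceaBrandenLiggett2007, §3.2 (A⟨S⟩ = det(A[S']), μ_A(S) = A⟨S⟩ det(A+I)^{−1})] -/
def coMinorWeight (A : Matrix n n ℝ) : Finset n → ℝ := fun S => principalMinorMap A Sᶜ

/-- **GKK-matrix** (Gantmacher–Krein–Kotelyansky): a P-matrix satisfying the Hadamard–Fischer–Kotelyansky
inequalities `A⟨S⟩ A⟨T⟩ ≥ A⟨S ∪ T⟩ A⟨S ∩ T⟩` — «μ_A satisfies the negative lattice condition».
[cite: BorceaBrandenLiggett2007, §3.2 (eq. HFK)] -/
def IsGKK (A : Matrix n n ℝ) : Prop :=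
  IsPMatrix A ∧ ∀ S T : Finset n, coMinorWeight A (S ∪ T) * coMinorWeight A (S ∩ T) ≤ coMinorWeight A S * coMinorWeight A T

/-- **Definition 3.1 (Rayleigh matrix)**: a P-matrix whose weight `μ_A` is Rayleigh (Def. 2.5, tree
`IsRayleigh`). [cite: BorceaBrandenLiggett2007, §3.2 Def. 3.1] -/
def IsRayleighMatrix (A : Matrix n n ℝ) : Prop := IsPMatrix A ∧ IsRayleigh (coMinorWeight A)

/-- Unfolding `IsPMatrix`. [cite: BorceaBrandenLiggett2007, §3.2] -/
theorem isPMatrix_iff (A : Matrix n n ℝ) : IsPMatrix A ↔ ∀ S : Finset n, 0 < principalMinorMap A S := Iff.rfl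

/-- Unfolding `coMinorWeight`: `μ_A(S) = det A[Sᶜ]`. [cite: BorceaBrandenLiggett2007, §3.2] -/
theorem coMinorWeight_apply (A : Matrix n n ℝ) (S : Finset n) : coMinorWeight A S = principalMinorMap A Sᶜ := rfl

/-- `A⟨[n]⟩ = det A[∅] = 1`. [cite: BorceaBrandenLiggett2007, §3.2 («A⟨[n]⟩ = det(A[∅]) := 1»)] -/
theorem coMinorWeight_univ (A : Matrix n n ℝ) : coMinorWeight A univ = 1 := by
  rw [coMinorWeight_apply, Finset.compl_univ, principalMinorMap_empty]

/-- `A⟨∅⟩ = det A`. [cite: BorceaBrandenLiggett2007, §3.2] -/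
theorem coMinorWeight_empty (A : Matrix n n ℝ) : coMinorWeight A ∅ = A.det := by
  rw [coMinorWeight_apply, Finset.compl_empty, principalMinorMap_univ]

/-- **GKK ⟺ P-matrix whose weight `μ_A` is NLC** («In other words, an n × n P-matrix A is GKK if and only if
the probability measure μ_A … satisfies the negative lattice condition»). [cite: BorceaBrandenLiggett2007, §3.2] -/
theorem isGKK_iff_isNLC (A : Matrix n n ℝ) : IsGKK A ↔ IsPMatrix A ∧ IsNLC (coMinorWeight A) := Iff.rfl

/-- Unfolding Def. 3.1. [cite: BorceaBrandenLiggett2007, §3.2 Def. 3.1] -/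
theorem isRayleighMatrix_iff (A : Matrix n n ℝ) :
    IsRayleighMatrix A ↔ IsPMatrix A ∧ IsRayleigh (coMinorWeight A) := Iff.rfl

/-- The weight of a P-matrix is positive. [cite: BorceaBrandenLiggett2007, §3.2] -/
theorem IsPMatrix.coMinorWeight_pos {A : Matrix n n ℝ} (h : IsPMatrix A) (S : Finset n) : 0 < coMinorWeight A S :=
  h Sᶜ

end Defs

/-! ## §2 The generating polynomial: `Σ_S A⟨S⟩ z^S = det(A + Z)` -/

section GeneratingPolynomial

variable {n : Type*} [Fintype n] [DecidableEq n]

/-- **«`g_{μ_A}(z) = Σ_{S ⊆ [n]} A⟨S⟩ z^S = det(A + Z)`, `Z = diag(z_1,…,z_n)`»** (unnormalised), at every real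
point: the principal-minor expansion of `det(A + diag x)` (tree `det_add_diagonal_eq_sum_minors`).
[cite: BorceaBrandenLiggett2007, §3.2] -/
theorem eval_multiAffine_coMinorWeight (A : Matrix n n ℝ) (x : n → ℝ) :
    MvPolynomial.eval x (multiAffine (coMinorWeight A)) = (A + diagonal x).det := by
  rw [eval_multiAffine, det_add_diagonal_eq_sum_minors]
  refine (Fintype.sum_bijective _ compl_bijective
    (fun S : Finset n => (∏ i ∈ Sᶜ, x i) * (A.submatrix ((↑) : S → n) ((↑) : S → n)).det)
    (fun T : Finset n => coMinorWeight A T * ∏ i ∈ T, x i) fun S => ?_).symm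
  show _ = coMinorWeight A Sᶜ * ∏ i ∈ Sᶜ, x i
  rw [coMinorWeight_apply, compl_compl, mul_comm]
  rfl

/-- `multiAffine` is injective on real weights (coefficient extraction over `ℂ`). [folklore] -/
private theorem multiAffine_injective' {σ : Type*} [Fintype σ] {μ ν : Finset σ → ℝ}
    (h : multiAffine μ = multiAffine ν) : μ = ν := by
  have h0 : multiAffine (μ - ν) = 0 := by rw [← multiAffine_sub, h, sub_self]
  have hC : multiAffine (⇑(algebraMap ℝ ℂ) ∘ (μ - ν)) = 0 := by
    have := congrArg (MvPolynomial.map (algebraMap ℝ ℂ)) h0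
    rwa [map_multiAffine, map_zero] at this
  funext S
  have hS := (multiAffine_eq_zero_iff _).1 hC S
  simp only [Function.comp_apply, Pi.sub_apply, map_sub, sub_eq_zero] at hS
  exact_mod_cast hS

/-- **`μ_{A+X}` is the translate of `μ_A`**: `g_{μ_{A+X}}(z) = det(A + X + Z) = g_{μ_A}(z + x)` — «the set of all
Rayleigh matrices is obviously closed under adding positive diagonal matrices». [cite: BorceaBrandenLiggett2007,
§3.2 (proof of Thm. 3.3)] [cite: BorceaBrandenLiggett2007, §2.1 Prop. 2.1 (2) (translation f(z+α))] -/
theorem coMinorWeight_add_diagonal (A : Matrix n n ℝ) (x : n → ℝ) :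
    coMinorWeight (A + diagonal x) = translW x (coMinorWeight A) := by
  apply multiAffine_injective'
  refine MvPolynomial.funext fun z => ?_
  rw [eval_multiAffine_coMinorWeight, eval_multiAffine_translW, eval_multiAffine_coMinorWeight, add_assoc, diagonal_add]
  have hxz : (fun i => x i + z i) = fun i => z i + x i := funext fun i => add_comm _ _
  rw [hxz]

end GeneratingPolynomial

/-! ## §3 Values of a translate; NLC of all translates ⟺ Rayleigh -/

section Translates

variable {σ : Type*} [Fintype σ] [DecidableEq σ]

/-- `translW a μ S = Σ_{T : T ∩ S = ∅} μ(S ∪ T) a^T` (substitute `T ↦ S ∪ T`). [cite: BorceaBrandenLiggett2007,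
§2.1 Prop. 2.1 (2)] -/
theorem translW_eq_sum_disjoint (a : σ → ℝ) (μ : Finset σ → ℝ) (S : Finset σ) :
    translW a μ S = ∑ T : Finset σ, if Disjoint S T then μ (S ∪ T) * ∏ k ∈ T, a k else 0 := by
  rw [translW_apply, ← sum_filter, ← sum_filter]
  refine sum_nbij' (fun T => T \ S) (fun U => S ∪ U) ?_ ?_ ?_ ?_ ?_
  · intro T hT
    simp only [mem_filter, mem_univ, true_and] at hT ⊢
    exact disjoint_sdiff
  · intro U hU
    simp only [mem_filter, mem_univ, true_and] at hU ⊢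
    exact subset_union_left
  · intro T hT
    simp only [mem_filter, mem_univ, true_and] at hT
    exact union_sdiff_of_subset hT
  · intro U hU
    simp only [mem_filter, mem_univ, true_and] at hU
    exact union_sdiff_cancel_left hU
  · intro T hT
    simp only [mem_filter, mem_univ, true_and] at hT
    rw [union_sdiff_of_subset hT]

/-- `translW a μ ∅ = g_μ(a)`. [cite: BorceaBrandenLiggett2007, §2.1 Prop. 2.1 (2)] -/
theorem translW_empty (a : σ → ℝ) (μ : Finset σ → ℝ) :
    translW a μ ∅ = MvPolynomial.eval a (multiAffine μ) := by
  rw [translW_eq_sum_disjoint, eval_multiAffine]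
  exact sum_congr rfl fun T _ => by rw [if_pos (disjoint_empty_left T), empty_union]

/-- `translW a μ {i} = ∂_i g_μ(a)` (= `g_{∂_i μ}(a)`, the tree's `derivWeight`). [cite: BorceaBrandenLiggett2007,
§2.1 Prop. 2.1 (2), Def. 2.5] -/
theorem translW_singleton (a : σ → ℝ) (μ : Finset σ → ℝ) (i : σ) :
    translW a μ {i} = MvPolynomial.eval a (multiAffine (derivWeight i μ)) := by
  rw [translW_eq_sum_disjoint, eval_multiAffine]
  refine sum_congr rfl fun T _ => ?_
  rw [derivWeight_apply]
  by_cases h : i ∈ T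
  · rw [if_neg (fun hd => disjoint_singleton_left.1 hd h), if_pos h, zero_mul]
  · rw [if_pos (disjoint_singleton_left.2 h), if_neg h, insert_eq]

/-- `translW a μ {i,j} = ∂_i∂_j g_μ(a)` for `i ≠ j`. [cite: BorceaBrandenLiggett2007, §2.1 Prop. 2.1 (2), Def. 2.5] -/
theorem translW_pair (a : σ → ℝ) (μ : Finset σ → ℝ) {i j : σ} (hij : i ≠ j) :
    translW a μ {i, j} = MvPolynomial.eval a (multiAffine (derivWeight i (derivWeight j μ))) := by
  rw [translW_eq_sum_disjoint, eval_multiAffine]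
  refine sum_congr rfl fun T _ => ?_
  rw [derivWeight_apply, derivWeight_apply]
  by_cases hi : i ∈ T
  · rw [if_neg (fun hd => (disjoint_left.1 hd (mem_insert_self i {j})) hi), if_pos hi, zero_mul]
  · by_cases hj : j ∈ T
    · rw [if_neg (fun hd => (disjoint_left.1 hd (mem_insert_of_mem (mem_singleton_self j))) hj), if_neg hi,
        if_pos (mem_insert_of_mem hj), zero_mul]
    · have hj' : j ∉ insert i T := by
        rw [mem_insert]
        exact fun h => h.elim (fun h => hij h.symm) hj
      have hd : Disjoint ({i, j} : Finset σ) T := by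
        rw [disjoint_left]
        intro k hk
        rcases mem_insert.1 hk with rfl | hk
        · exact hi
        · rw [mem_singleton.1 hk]; exact hj
      rw [if_pos hd, if_neg hi, if_neg hj']
      congr 2
      ext k
      simp only [mem_union, mem_insert, mem_singleton]
      tauto

/-- A nonnegative weight is dominated by its translates: `μ(S) ≤ translW a μ S` for `a ≥ 0` (the term `T = S`).
[cite: BorceaBrandenLiggett2007, §2.1 Prop. 2.1 (2)] -/
theorem le_translW {μ : Finset σ → ℝ} (h0 : ∀ S, 0 ≤ μ S) {a : σ → ℝ} (ha : ∀ i, 0 ≤ a i) (S : Finset σ) :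
    μ S ≤ translW a μ S := by
  rw [translW_apply]
  have h := single_le_sum (s := (univ : Finset (Finset σ)))
    (f := fun T => if S ⊆ T then μ T * ∏ i ∈ T \ S, a i else 0) (fun T _ => ?_) (mem_univ S)
  · simpa only [Subset.refl, if_true, _root_.sdiff_self, Finset.bot_eq_empty, prod_empty, mul_one] using h
  · show 0 ≤ (if S ⊆ T then μ T * ∏ i ∈ T \ S, a i else 0)
    split_ifs
    · exact mul_nonneg (h0 T) (prod_nonneg fun i _ => ha i)
    · exact le_rfl

/-- **If every translate `g_μ(z + a)`, `a ∈ (0,∞)^σ`, is NLC then `μ` is Rayleigh** — the mechanism of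
(2) ⇒ (1): NLC of the translate at `S = {i}`, `T = {j}` reads `∂_i g(a) ∂_j g(a) ≥ ∂_i∂_j g(a) g(a)`.
[cite: BorceaBrandenLiggett2007, §3.2 Thm. 3.3 (proof of (2) ⇒ (1))] -/
theorem isRayleigh_of_forall_isNLC_translW {μ : Finset σ → ℝ}
    (h : ∀ a : σ → ℝ, (∀ k, 0 < a k) → IsNLC (translW a μ)) : IsRayleigh μ := by
  rw [isRayleigh_iff]
  intro x hx i j
  by_cases hij : i = j
  · subst hij
    have h0 : ∀ T, derivWeight i (derivWeight i μ) T = 0 := by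
      intro T
      rw [derivWeight_apply]
      split_ifs with h
      · rfl
      · rw [derivWeight_apply, if_pos (mem_insert_self i T)]
    have h0' : MvPolynomial.eval x (multiAffine (derivWeight i (derivWeight i μ))) = 0 := by
      rw [eval_multiAffine]
      exact sum_eq_zero fun T _ => by rw [h0 T, zero_mul]
    rw [h0', zero_mul]
    exact mul_self_nonneg _
  · have hN := h x hx {i} {j}
    rw [← insert_eq, singleton_inter_of_notMem (by rwa [mem_singleton]), translW_pair x μ hij, translW_empty,
      translW_singleton, translW_singleton] at hN
    exact hN

/-- Conversely, every nonnegative translate of a nonnegative Rayleigh weight is NLC (Prop. 2.1 (2): translates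
are Rayleigh; Wagner: Rayleigh ⟹ NLC — tree `isRayleigh_translW`, `IsRayleigh.isNLC`).
[cite: BorceaBrandenLiggett2007, §2.1 Prop. 2.1 (2) and §3.2 («by [W] Rayleigh matrices are GKK»)] -/
theorem IsRayleigh.isNLC_translW {μ : Finset σ → ℝ} (h : IsRayleigh μ) (h0 : ∀ S, 0 ≤ μ S) {a : σ → ℝ}
    (ha : ∀ i, 0 ≤ a i) : IsNLC (translW a μ) :=
  (isRayleigh_translW h ha).isNLC (translW_nonneg h0 ha)

end Translates

/-! ## §4 Theorem 3.3 -/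

section Theorem33

variable {n : Type*} [Fintype n] [DecidableEq n]

/-- Adding a nonnegative diagonal matrix to a P-matrix gives a P-matrix (every principal minor of `A + X` is
`≥` the corresponding minor of `A`). [cite: BorceaBrandenLiggett2007, §3.2 (proof of Thm. 3.3, (1) ⇒ (2))] -/
theorem IsPMatrix.add_diagonal {A : Matrix n n ℝ} (h : IsPMatrix A) {x : n → ℝ} (hx : ∀ i, 0 ≤ x i) :
    IsPMatrix (A + diagonal x) := by
  intro S
  have hS : principalMinorMap (A + diagonal x) S = coMinorWeight (A + diagonal x) Sᶜ := by
    rw [coMinorWeight_apply, compl_compl]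
  rw [hS, coMinorWeight_add_diagonal]
  exact lt_of_lt_of_le (h.coMinorWeight_pos Sᶜ) (le_translW (fun T => (h.coMinorWeight_pos T).le) hx Sᶜ)

/-- **Theorem 3.3 (Borcea–Brändén–Liggett).** For a real square matrix `A` the following are equivalent:
(1) `A` is a Rayleigh matrix; (2) `A + X` is a GKK-matrix for every diagonal `X = diag(x)` with `x ≥ 0`.
[cite: BorceaBrandenLiggett2007, §3.2 Thm. 3.3] -/
theorem BorceaBrandenLiggett_thm_3_3 (A : Matrix n n ℝ) :
    IsRayleighMatrix A ↔ ∀ x : n → ℝ, (∀ i, 0 ≤ x i) → IsGKK (A + diagonal x) := by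
  constructor
  · rintro ⟨hP, hR⟩ x hx
    refine ⟨hP.add_diagonal hx, ?_⟩
    rw [coMinorWeight_add_diagonal]
    exact hR.isNLC_translW (fun T => (hP.coMinorWeight_pos T).le) hx
  · intro h
    have hA : IsGKK A := by simpa using h 0 fun _ => le_rfl
    refine ⟨hA.1, isRayleigh_of_forall_isNLC_translW fun x hx => ?_⟩
    rw [← coMinorWeight_add_diagonal]
    exact (h x fun i => (hx i).le).2

/-- «By [W], Rayleigh matrices are GKK» (`X = 0`). [cite: BorceaBrandenLiggett2007, §3.2 (before Thm. 3.3)] -/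
theorem IsRayleighMatrix.isGKK {A : Matrix n n ℝ} (h : IsRayleighMatrix A) : IsGKK A := by
  simpa using (BorceaBrandenLiggett_thm_3_3 A).1 h 0 fun _ => le_rfl

/-- «The set of all Rayleigh matrices is obviously closed under adding positive diagonal matrices.»
[cite: BorceaBrandenLiggett2007, §3.2 (proof of Thm. 3.3)] -/
theorem IsRayleighMatrix.add_diagonal {A : Matrix n n ℝ} (h : IsRayleighMatrix A) {x : n → ℝ}
    (hx : ∀ i, 0 ≤ x i) : IsRayleighMatrix (A + diagonal x) := by
  refine ⟨h.1.add_diagonal hx, ?_⟩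
  rw [coMinorWeight_add_diagonal]
  exact isRayleigh_translW h.2 hx

/-- The normalising constant is positive: `det(A + I) = g_{μ_A}(𝟙) = Σ_S A⟨S⟩ > 0` for a P-matrix.
[cite: BorceaBrandenLiggett2007, §3.2 (μ_A(S) = A⟨S⟩ det(A+I)^{−1})] -/
theorem IsPMatrix.det_add_one_pos {A : Matrix n n ℝ} (h : IsPMatrix A) : 0 < (A + 1).det := by
  have h1 : (A + 1).det = MvPolynomial.eval (fun _ => (1 : ℝ)) (multiAffine (coMinorWeight A)) := by
    rw [eval_multiAffine_coMinorWeight, diagonal_one]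
  rw [h1, eval_multiAffine]
  refine sum_pos (fun S _ => ?_) univ_nonempty
  rw [prod_const_one, mul_one]
  exact h.coMinorWeight_pos S

end Theorem33

/-! ## §5 Positive definite matrices are GKK, hence Rayleigh -/

section PosDef

variable {n : Type*} [Fintype n] [DecidableEq n]

/-- The tree's `principalMinorMap A S` as a minor indexed by a predicate subtype (the form of the tree's
`FischerInequality`). [cite: BorceaBrandenLiggett2007, §3.2 (A[S])] -/
theorem principalMinorMap_eq_det_submatrix_subtype (A : Matrix n n ℝ) (S : Finset n) (p : n → Prop)
    [DecidablePred p] (h : ∀ x, x ∈ S ↔ p x) :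
    principalMinorMap A S = (A.submatrix (Subtype.val : {i // p i} → n) Subtype.val).det := by
  let e : {i // p i} ≃ (S : Type _) := Equiv.subtypeEquivRight fun x => (h x).symm
  unfold principalMinorMap
  rw [← Matrix.det_submatrix_equiv_self e]
  rfl

/-- Every principal minor of a positive definite matrix is positive: positive definite matrices are
P-matrices. [cite: BorceaBrandenLiggett2007, §3.2 («(I) Positive definite matrices»)] -/
theorem isPMatrix_of_posDef {A : Matrix n n ℝ} (hA : A.PosDef) : IsPMatrix A :=
  fun _ => (hA.submatrix Subtype.val_injective).det_pos

/-- **«Examples of GKK-matrices are: (I) Positive definite matrices»** — Koteljanskii's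
(Hadamard–Fischer–Kotelyansky) inequality `det A[α ∪ β] det A[α ∩ β] ≤ det A[α] det A[β]`, applied to the
complements. [cite: BorceaBrandenLiggett2007, §3.2 (Examples (I))] [cite: HornJohnson2013, Thm 7.8.9] -/
theorem isGKK_of_posDef {A : Matrix n n ℝ} (hA : A.PosDef) : IsGKK A := by
  refine ⟨isPMatrix_of_posDef hA, fun S T => ?_⟩
  rw [coMinorWeight_apply, coMinorWeight_apply, coMinorWeight_apply, coMinorWeight_apply, Finset.compl_union,
    Finset.compl_inter,
    principalMinorMap_eq_det_submatrix_subtype A (Sᶜ ∩ Tᶜ) (fun x => x ∈ Sᶜ ∧ x ∈ Tᶜ) (fun x => mem_inter),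
    principalMinorMap_eq_det_submatrix_subtype A (Sᶜ ∪ Tᶜ) (fun x => x ∈ Sᶜ ∨ x ∈ Tᶜ) (fun x => mem_union),
    principalMinorMap_eq_det_submatrix_subtype A Sᶜ (fun x => x ∈ Sᶜ) (fun x => Iff.rfl),
    principalMinorMap_eq_det_submatrix_subtype A Tᶜ (fun x => x ∈ Tᶜ) (fun x => Iff.rfl), mul_comm]
  exact det_submatrix_union_mul_det_submatrix_inter_le hA (fun x => x ∈ Sᶜ) (fun x => x ∈ Tᶜ)

/-- **«It follows immediately from Theorem 3.3 that … positive definite matrices are Rayleigh»** (`A + X` is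
positive definite, hence GKK, for every diagonal `X ≥ 0`). [cite: BorceaBrandenLiggett2007, §3.2 (after
Thm. 3.3)] -/
theorem isRayleighMatrix_of_posDef {A : Matrix n n ℝ} (hA : A.PosDef) : IsRayleighMatrix A :=
  (BorceaBrandenLiggett_thm_3_3 A).2 fun _ hx =>
    isGKK_of_posDef (hA.add_posSemidef (Matrix.PosSemidef.diagonal fun i => hx i))

/-- The weight `S ↦ det A[[n] ∖ S]` of a positive definite (real symmetric) matrix is a Rayleigh measure.
[cite: BorceaBrandenLiggett2007, §3.2 (after Thm. 3.3), Def. 3.1] -/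
theorem isRayleigh_coMinorWeight_of_posDef {A : Matrix n n ℝ} (hA : A.PosDef) : IsRayleigh (coMinorWeight A) :=
  (isRayleighMatrix_of_posDef hA).2

end PosDef

/-! ## §6 Prop. 3.2: `det(A + Z)` is real stable for positive semidefinite `A` — `μ_A` is strongly Rayleigh -/

section StronglyRayleigh

variable {n : Type*} [Fintype n] [DecidableEq n]

/-- **`A + Z = Σ_i z_i E_{ii} + A`**: the pencil of the diagonal unit matrices with constant term `A`.
[cite: BorceaBrandenLiggett2007, §3.1 Prop. 3.2 («if Z = diag(z_1,…,z_m) and A is positive semi-definite …»)] -/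
theorem affinePencilMatrix_diagonal_single (A : Matrix n n ℝ) :
    affinePencilMatrix (fun i : n => Matrix.diagonal (Pi.single i (1 : ℝ))) A =
      A.map C + Matrix.diagonal fun i => (X i : MvPolynomial n ℝ) := by
  refine Matrix.ext fun p q => ?_
  rw [affinePencilMatrix_apply, Matrix.add_apply, Matrix.map_apply, Matrix.diagonal_apply, add_comm (C (A p q))]
  congr 1
  by_cases hpq : p = q
  · subst hpq
    rw [if_pos rfl]
    have h1 : ∀ i : n, C (Matrix.diagonal (Pi.single i (1 : ℝ)) p p) * (X i : MvPolynomial n ℝ) =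
        if p = i then X i else 0 := by
      intro i
      rw [Matrix.diagonal_apply_eq, Pi.single_apply]
      split_ifs <;> simp
    simp_rw [h1]
    rw [Finset.sum_ite_eq, if_pos (Finset.mem_univ _)]
  · rw [if_neg hpq]
    refine Finset.sum_eq_zero fun i _ => ?_
    rw [Matrix.diagonal_apply_ne _ hpq, C_0, zero_mul]

/-- **`g_{μ_A}(z) = det(A + Z)` as polynomials** (`Z = diag(z)`). [cite: BorceaBrandenLiggett2007, §3.2
(«g_{μ_A}(z) = det(A+I)^{−1} det(A+Z)»)] -/
theorem multiAffine_coMinorWeight (A : Matrix n n ℝ) :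
    multiAffine (coMinorWeight A) = (A.map C + Matrix.diagonal fun i => (X i : MvPolynomial n ℝ)).det := by
  refine MvPolynomial.funext fun x => ?_
  rw [eval_multiAffine_coMinorWeight, RingHom.map_det, map_add, RingHom.mapMatrix_apply, RingHom.mapMatrix_apply,
    Matrix.map_map, Matrix.diagonal_map (map_zero _)]
  congr 2
  · ext i j
    simp
  · ext i j
    simp [Matrix.diagonal_apply]

/-- `g_{μ_A} = det(Σ_i z_i E_{ii} + A)`, an affine determinantal pencil. [cite: BorceaBrandenLiggett2007, §3.1
Prop. 3.2] -/
theorem multiAffine_coMinorWeight_eq_detAffinePencil (A : Matrix n n ℝ) :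
    multiAffine (coMinorWeight A) = detAffinePencil (fun i : n => Matrix.diagonal (Pi.single i (1 : ℝ))) A := by
  rw [detAffinePencil, affinePencilMatrix_diagonal_single, multiAffine_coMinorWeight]

/-- **Prop. 3.2 for `det(A + Z)`**: for a positive semidefinite (real symmetric) `A` the weight
`μ_A : S ↦ det A[Sᶜ]` is strongly Rayleigh (or zero). [cite: BorceaBrandenLiggett2007, §3.1 Prop. 3.2 («det(A+Z)
is a multi-affine real stable polynomial … a (positive) constant multiple of a strongly Rayleigh polynomial»)] -/
theorem stableOrZero_coMinorWeight_of_posSemidef {A : Matrix n n ℝ} (hA : A.PosSemidef) :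
    StableOrZero (coMinorWeight A) := by
  rw [stableOrZero_iff, multiAffine_coMinorWeight_eq_detAffinePencil]
  refine detAffinePencil_eq_zero_or_isRealStable (fun i => Matrix.PosSemidef.diagonal fun k => ?_) hA.1
  rw [Pi.zero_apply, Pi.single_apply]
  split_ifs <;> norm_num

/-- «`det(A + Z)` is a multi-affine real stable polynomial» for `A ⪰ 0` (not zero: the coefficient of `z^{[n]}`
is `A⟨[n]⟩ = 1`). [cite: BorceaBrandenLiggett2007, §3.1 Prop. 3.2] -/
theorem isRealStable_multiAffine_coMinorWeight_of_posSemidef {A : Matrix n n ℝ} (hA : A.PosSemidef) :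
    IsRealStable (multiAffine (coMinorWeight A)) := by
  rcases stableOrZero_coMinorWeight_of_posSemidef hA with h0 | hst
  · exact absurd (h0 univ) (by rw [coMinorWeight_univ]; exact one_ne_zero)
  · exact (isRealStable_multiAffine_iff _).2 hst

/-- «with all non-negative coefficients»: `det A[Sᶜ] ≥ 0` for `A ⪰ 0`. [cite: BorceaBrandenLiggett2007, §3.1
Prop. 3.2 (2)] -/
theorem coMinorWeight_nonneg_of_posSemidef {A : Matrix n n ℝ} (hA : A.PosSemidef) (S : Finset n) :
    0 ≤ coMinorWeight A S :=
  (hA.submatrix _).det_nonneg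

/-- The weight `μ_A` of a positive semidefinite matrix is CNA+ (strongly Rayleigh ⟹ CNA+, Thm. 4.9).
[cite: BorceaBrandenLiggett2007, §3.1 Prop. 3.2 with §4.2 Thm. 4.9] -/
theorem isCNAPlus_coMinorWeight_of_posSemidef {A : Matrix n n ℝ} (hA : A.PosSemidef) :
    IsCNAPlus (coMinorWeight A) :=
  (stableOrZero_coMinorWeight_of_posSemidef hA).isCNAPlus (coMinorWeight_nonneg_of_posSemidef hA)

end StronglyRayleigh

/-! ## §7 ULC rank sequences -/

section ULC

/-- **Strongly Rayleigh measures have ULC rank sequences** («the ULC property for rank sequences»; BBL via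
Newton's inequalities — here: the symmetrization of a strongly Rayleigh weight is strongly Rayleigh
(`stableOrZero_symmW`), hence Rayleigh, hence NLC, and an exchangeable NLC weight has a ULC rank sequence
(Thm. 3.7, tree `isUltraLogConcave_rankSeq_of_isNLC_symmW`); the rank sequence is symmetrization-invariant).
[cite: BorceaBrandenLiggett2007, §3 (list of properties of strongly Rayleigh measures: «the ULC property for
rank sequences») with §3.5 Thm. 3.7 and §4.4 Remark 4.5] -/
theorem StableOrZero.isUltraLogConcave_rankSeq {σ : Type*} [Fintype σ] [DecidableEq σ] {μ : Finset σ → ℝ}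
    (h : StableOrZero μ) (h0 : ∀ S, 0 ≤ μ S) : IsUltraLogConcave (Fintype.card σ) (rankSeq μ) :=
  isUltraLogConcave_rankSeq_of_isNLC_symmW h0 ((stableOrZero_symmW h).isRayleigh.isNLC (symmW_nonneg h0))

variable {n : Type*} [Fintype n] [DecidableEq n]

/-- **«The measures associated with positive definite … matrices have ULC rank sequences»** (here for all
positive semidefinite real symmetric `A`). [cite: BorceaBrandenLiggett2007, §3.2 («This follows from Newton's
inequalities and the fact that Hermitian matrices … have real-rooted characteristic polynomials»)] -/
theorem isUltraLogConcave_rankSeq_coMinorWeight_of_posSemidef {A : Matrix n n ℝ} (hA : A.PosSemidef) :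
    IsUltraLogConcave (Fintype.card n) (rankSeq (coMinorWeight A)) :=
  (stableOrZero_coMinorWeight_of_posSemidef hA).isUltraLogConcave_rankSeq (coMinorWeight_nonneg_of_posSemidef hA)

end ULC

end Literature.Probability.NegativeDependence
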